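import Literature.Topology.PlanarFoliations.ZoneLeaves
import Literature.Topology.PlanarFoliations.PolygonLeaves
import Literature.Topology.PlanarFoliations.VanishingBand
import HarnessLib

/-!
# Terminal essential patterns are terminal zones; the vanishing cycle at a terminal compact leaf

Topic: Topology / PlanarFoliations, sequel to `ZoneLeaves.lean` (terminal zones: inner leaves are
separatrices, inner leaves near the trace are compact and image-null), `PolygonLeaves.lean` (the
trace of a simple polygon in a flow box), `PatternMinimiser.lean`/`TerminalPattern.lean` (terminal
essential patterns of the minimiser scheme), `VanishingBand.lean` (a vanishing cycle from an
essential compact leaf bordering a band of image-null leaves).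

* `exists_oneSided'` (**proved**): at a point of the domain on a Jordan trace made of leaves, one
  side of its plaque is inside and the other outside (no hugging leaf needed);
* the zone hypotheses of `NoInnerSpiral`/`ZoneLeaves` for a **terminal compact pattern** `K`
  (`hcpt`: an essential compact leaf inside would be a smaller minimiser; `hpoly`: no essential
  polygon fills the disc of a compact leaf; `hloc`: a compact leaf meets a vertical once) and for a
  **terminal polygon pattern** `P` (`PolyPattern.imageNull_of_compact_inside`,
  `PolyPattern.mem_range_of_essential`);
* `CompactPattern.nonempty_vanishingCycle_of_terminal` (**proved**): **a terminal essential compact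
  leaf yields a vanishing cycle** — the leaves through its inner vertical near it are compact and
  image-null (`eventually_compact_imageNull`), so `VanishingBand.exists_vanishingCycle` applies.

## References

* C. Camacho, A. Lins Neto, *Geometric Theory of Foliations*, Birkhäuser (1985), Ch. VII §2
  [CamachoLinsNeto1985].
-/

noncomputable section

open Set Filter Function Metric
open _root_.Topology
open Literature.Topology.FourManifolds Literature.Topology.FourManifolds.Foliation Literature.Topology.PlaneTopology

namespace Literature.Topology.PlanarFoliations

variable {X : Type*} [TopologicalSpace X] [T2Space X] [SecondCountableTopology X] [Nonempty X] {F : Foliation ℝ X} {ι : X → ℂ}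
variable {B : Type*} [NormedAddCommGroup B] [NormedSpace ℝ B] [LocallyConnectedSpace B] {M : Type*} [TopologicalSpace M]
  {T : Foliation B M} {g : ℂ → M}

/-! ## One-sidedness at a point of a trace of leaves -/

omit [T2Space X] [SecondCountableTopology X] [Nonempty X] in
/-- **One-sidedness of the inside at a point of the domain on a Jordan trace of leaves**: read in
a flow box in which the trace near the point is its plaque, the points of the box at heights on
one side `s` are inside, those on the other side are not. [folklore] -/
theorem exists_oneSided' {γ : ℝ → ℂ} (hJ : IsJordanLoop γ)
    (hsat : ∀ x', ι x' ∈ range γ → ∀ x'' ∈ F.leaf x', ι x'' ∈ range γ)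
    {xk : X} (hk : ι xk ∈ range γ) {e : OpenPartialHomeomorph X (ℝ × ℝ)} (he : e ∈ F.atlas)
    (hloc : ∃ ε > 0, ∀ x', ι x' ∈ range γ → x' ∈ e.source →
      |(e x').1 - (e xk).1| < ε → |(e x').2 - (e xk).2| < ε → (e x').2 = (e xk).2)
    (hι : IsOpenEmbedding ι) (hxke : xk ∈ e.source) :
    ∃ s : ℝ, (s = 1 ∨ s = -1) ∧ ∃ ε > 0,
      (∀ u t, |u - (e xk).1| < ε → |t - (e xk).2| < ε → 0 < s * (t - (e xk).2) → ι (e.symm (u, t)) ∈ IsJordanLoop.inside γ) ∧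
      (∀ u t, |u - (e xk).1| < ε → |t - (e xk).2| < ε → 0 < -s * (t - (e xk).2) → ι (e.symm (u, t)) ∉ IsJordanLoop.inside γ) := by
  obtain ⟨ε, hε, hplaque⟩ := hloc
  set u₀ := (e xk).1 with hu₀
  set t₀ := (e xk).2 with ht₀
  have hιc := hι.continuous
  have htarget : ∀ p : ℝ × ℝ, p ∈ e.target := fun p ↦ by rw [F.target_eq e he]; exact mem_univ _
  have hsymm_src : ∀ p : ℝ × ℝ, e.symm p ∈ e.source := fun p ↦ e.map_target (htarget p)
  have he_symm : ∀ p : ℝ × ℝ, e (e.symm p) = p := fun p ↦ e.right_inv (htarget p)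
  have hxk : e.symm (u₀, t₀) = xk := by rw [show (u₀, t₀) = e xk from rfl, e.left_inv hxke]
  set Φ : ℝ × ℝ → ℂ := fun p ↦ ι (e.symm p) with hΦ
  have hcont : Continuous Φ := hιc.comp (SackData.continuous_symm (F := F) he)
  set Hp : Set ℂ := Φ '' (Ioo (u₀ - ε) (u₀ + ε) ×ˢ Ioo t₀ (t₀ + ε)) with hHp
  set Hm : Set ℂ := Φ '' (Ioo (u₀ - ε) (u₀ + ε) ×ˢ Ioo (t₀ - ε) t₀) with hHm
  have hoff : ∀ u t, u ∈ Ioo (u₀ - ε) (u₀ + ε) → t ∈ Ioo (t₀ - ε) (t₀ + ε) → t ≠ t₀ → Φ (u, t) ∉ range γ := by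
    intro u t hu ht htne hmem
    have h := hplaque (e.symm (u, t)) hmem (hsymm_src _)
      (by rw [he_symm]; exact abs_sub_lt_iff.2 ⟨by linarith [hu.2], by linarith [hu.1]⟩)
      (by rw [he_symm]; exact abs_sub_lt_iff.2 ⟨by linarith [ht.2], by linarith [ht.1]⟩)
    rw [he_symm] at h
    exact htne h
  have hside : ∀ {S : Set ℂ}, IsPreconnected S → S ⊆ (range γ)ᶜ →
      S ⊆ IsJordanLoop.inside γ ∨ S ⊆ IsJordanLoop.outside γ := fun {S} hS hSr ↦
    hS.subset_or_subset hJ.isOpen_inside hJ.isOpen_outside IsJordanLoop.disjoint_inside_outside fun z hz ↦ by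
      by_cases h : z ∈ IsJordanLoop.inside γ
      · exact Or.inl h
      · exact Or.inr ((IsJordanLoop.mem_outside_iff_not_mem_inside (hSr hz)).2 h)
  have hHp_side := hside (((convex_Ioo _ _).prod (convex_Ioo _ _)).isPreconnected.image _ hcont.continuousOn)
    (by rintro _ ⟨⟨u, t⟩, ⟨hu, ht⟩, rfl⟩; exact hoff u t hu ⟨by linarith [ht.1], ht.2⟩ ht.1.ne')
  have hHm_side := hside (((convex_Ioo _ _).prod (convex_Ioo _ _)).isPreconnected.image _ hcont.continuousOn)
    (by rintro _ ⟨⟨u, t⟩, ⟨hu, ht⟩, rfl⟩; exact hoff u t hu ⟨ht.1, by linarith [ht.2]⟩ ht.2.ne)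
  have hopen : IsOpen (Φ '' (Ioo (u₀ - ε) (u₀ + ε) ×ˢ Ioo (t₀ - ε) (t₀ + ε))) :=
    (isOpenEmbedding_symm he hι).isOpenMap _ (isOpen_Ioo.prod isOpen_Ioo)
  have hxkmem : ι xk ∈ Φ '' (Ioo (u₀ - ε) (u₀ + ε) ×ˢ Ioo (t₀ - ε) (t₀ + ε)) :=
    ⟨(u₀, t₀), ⟨⟨by linarith, by linarith⟩, ⟨by linarith, by linarith⟩⟩, by simp only [hΦ]; rw [hxk]⟩
  have hnotboth : ¬ (Hp ⊆ IsJordanLoop.inside γ ∧ Hm ⊆ IsJordanLoop.inside γ) := by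
    rintro ⟨hp, hm⟩
    have hbox : Φ '' (Ioo (u₀ - ε) (u₀ + ε) ×ˢ Ioo (t₀ - ε) (t₀ + ε)) ⊆ IsJordanLoop.fill γ := by
      rintro _ ⟨⟨u', t'⟩, ⟨hu', ht'⟩, rfl⟩
      rcases lt_trichotomy t' t₀ with hlt | heq | hgt
      · exact Or.inr (hm ⟨(u', t'), ⟨hu', ht'.1, hlt⟩, rfl⟩)
      · rw [heq]
        rw [IsJordanLoop.fill, union_comm, ← hJ.closure_inside_eq]
        have hc : Tendsto (fun n : ℕ ↦ t₀ + ε / ((n : ℝ) + 2)) atTop (𝓝 t₀) := by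
          have h1 : Tendsto (fun n : ℕ ↦ ε * (1 / ((n : ℝ) + 1))) atTop (𝓝 (ε * 0)) :=
            tendsto_const_nhds.mul tendsto_one_div_add_atTop_nhds_zero_nat
          rw [mul_zero] at h1
          have h2 : Tendsto (fun n : ℕ ↦ ε / ((n : ℝ) + 2)) atTop (𝓝 0) :=
            squeeze_zero (fun n ↦ by positivity) (fun n ↦ by
              rw [mul_one_div]; exact div_le_div_of_nonneg_left hε.le (by positivity) (by linarith)) h1
          simpa using tendsto_const_nhds.add h2
        refine mem_closure_of_tendsto ((hcont.tendsto _).comp (tendsto_const_nhds.prodMk_nhds hc))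
          (Eventually.of_forall fun n ↦ hp ⟨(u', t₀ + ε / ((n : ℝ) + 2)), ⟨hu', ?_, ?_⟩, rfl⟩)
        · show t₀ < t₀ + ε / ((n : ℝ) + 2); have : 0 < ε / ((n : ℝ) + 2) := by positivity
          linarith
        · show t₀ + ε / ((n : ℝ) + 2) < t₀ + ε
          have : ε / ((n : ℝ) + 2) < ε := div_lt_self hε (by linarith [n.cast_nonneg (α := ℝ)])
          linarith
      · exact Or.inr (hp ⟨(u', t'), ⟨hu', hgt, ht'.2⟩, rfl⟩)
    have hint : ι xk ∈ interior (IsJordanLoop.fill γ) := interior_maximal hbox hopen hxkmem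
    rw [hJ.interior_fill] at hint
    exact hint.1 hk
  -- a point of the inside in the box: off the plaque of `xk`
  have hcl : ι xk ∈ closure (IsJordanLoop.inside γ) := by
    rw [hJ.closure_inside_eq]; exact Or.inr hk
  obtain ⟨z, ⟨⟨u, t⟩, ⟨hu, ht⟩, rfl⟩, hzin⟩ := (mem_closure_iff_nhds.1 hcl) _ (hopen.mem_nhds hxkmem)
  have htne : t ≠ t₀ := by
    intro htt
    -- on the plaque of `xk`: in the leaf of `xk`, on the trace
    have hx' : e.symm (u, t) ∈ F.leaf xk := by
      refine F.plaque_subset_leaf_of_mem he (F.mem_leaf_self xk) ⟨hxke, rfl⟩ ?_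
      rw [htt]; exact F.symm_mem_plaque he u t₀
    exact hzin.1 (hsat xk hk _ hx')
  have hdis := IsJordanLoop.disjoint_inside_outside (γ := γ)
  rcases lt_or_gt_of_ne htne with hlt | hgt
  · have hm : Hm ⊆ IsJordanLoop.inside γ := by
      rcases hHm_side with h | h
      · exact h
      · exact absurd (h ⟨(u, t), ⟨hu, ht.1, hlt⟩, rfl⟩) fun h' ↦ disjoint_left.1 hdis hzin h'
    have hp : Hp ⊆ IsJordanLoop.outside γ := by
      rcases hHp_side with h | h
      · exact absurd ⟨h, hm⟩ hnotboth
      · exact h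
    refine ⟨-1, Or.inr rfl, ε, hε, fun u' t' hu' ht' hst ↦ hm ⟨(u', t'), ⟨?_, ?_, by linarith⟩, rfl⟩,
      fun u' t' hu' ht' hst hin ↦ disjoint_left.1 hdis hin (hp ⟨(u', t'), ⟨?_, by linarith, ?_⟩, rfl⟩)⟩
    · exact abs_sub_lt_iff.1 hu' |> fun h ↦ ⟨by linarith [h.2], by linarith [h.1]⟩
    · exact abs_sub_lt_iff.1 ht' |> fun h ↦ by linarith [h.2]
    · exact abs_sub_lt_iff.1 hu' |> fun h ↦ ⟨by linarith [h.2], by linarith [h.1]⟩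
    · exact abs_sub_lt_iff.1 ht' |> fun h ↦ by linarith [h.1]
  · have hp : Hp ⊆ IsJordanLoop.inside γ := by
      rcases hHp_side with h | h
      · exact h
      · exact absurd (h ⟨(u, t), ⟨hu, hgt, ht.2⟩, rfl⟩) fun h' ↦ disjoint_left.1 hdis hzin h'
    have hm : Hm ⊆ IsJordanLoop.outside γ := by
      rcases hHm_side with h | h
      · exact absurd ⟨hp, h⟩ hnotboth
      · exact h
    refine ⟨1, Or.inl rfl, ε, hε, fun u' t' hu' ht' hst ↦ hp ⟨(u', t'), ⟨?_, by linarith, ?_⟩, rfl⟩,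
      fun u' t' hu' ht' hst hin ↦ disjoint_left.1 hdis hin (hm ⟨(u', t'), ⟨?_, ?_, by linarith⟩, rfl⟩)⟩
    · exact abs_sub_lt_iff.1 hu' |> fun h ↦ ⟨by linarith [h.2], by linarith [h.1]⟩
    · exact abs_sub_lt_iff.1 ht' |> fun h ↦ by linarith [h.1]
    · exact abs_sub_lt_iff.1 hu' |> fun h ↦ ⟨by linarith [h.2], by linarith [h.1]⟩
    · exact abs_sub_lt_iff.1 ht' |> fun h ↦ by linarith [h.2]

namespace StarData

variable (D : StarData F ι T g) (hbi : IsBiOriented F) (hι : IsOpenEmbedding ι) (ho : F.IsTransverselyOriented)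
  {x₀ : X} (hK₀ : IsCompact (F.leaf x₀)) (hC₀ : IsCompact (discLeaf F ι x₀)) (hΩ : discLeaf F ι x₀ ⊆ D.Ω)

/-! ## A terminal compact leaf is a terminal zone -/

namespace CompactPattern

variable {D} (K : D.CompactPattern x₀)
  (hterm : ∀ Q : D.CompactPattern x₀, discLeaf F ι Q.y ⊆ discLeaf F ι K.y → discLeaf F ι Q.y = discLeaf F ι K.y)
  (hpterm : ∀ Q : D.PolyPattern hbi hι x₀ hC₀, Q.Z.fill hι hC₀ ⊆ discLeaf F ι K.y → Q.Z.fill hι hC₀ = discLeaf F ι K.y)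

include hbi hι hterm in
omit [Nonempty X] [NormedSpace ℝ B] [LocallyConnectedSpace B] in
/-- **Inside a terminal compact leaf, compact leaves off it are image-null.** [folklore] -/
theorem imageNull_of_compact_inside {γ : ℝ → ℂ} (hr : range γ = ι '' F.leaf K.y)
    (hfill : IsJordanLoop.fill γ = discLeaf F ι K.y) (y' : X) (hK' : IsCompact (F.leaf y'))
    (hsub : ι '' F.leaf y' ⊆ IsJordanLoop.fill γ) (hdis : Disjoint (ι '' F.leaf y') (range γ)) : ImageNull D.foliated y' := by
  by_contra hess
  rw [hfill] at hsub
  have hdisc : discLeaf F ι y' ⊆ discLeaf F ι K.y := discLeaf_subset_discLeaf_of_image_subset hbi hι K.compact hK' hsub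
  let Q : D.CompactPattern x₀ := ⟨y', hK', hdisc.trans K.sub, hess⟩
  have heq : discLeaf F ι y' = discLeaf F ι K.y := hterm Q hdisc
  have hfr : ι '' F.leaf y' = ι '' F.leaf K.y := by
    rw [← frontier_discLeaf hbi hι hK', ← frontier_discLeaf hbi hι K.compact, heq]
  rw [hr, ← hfr] at hdis
  exact (disjoint_self.1 hdis).subset ⟨y', F.mem_leaf_self y', rfl⟩ |> fun h ↦ h

include hpterm in
omit [NormedSpace ℝ B] [LocallyConnectedSpace B] in
/-- **Inside a terminal compact leaf there is no essential polygon.** [folklore] -/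
theorem mem_range_of_essential {γ : ℝ → ℂ} (hJ : IsJordanLoop γ) (hfill : IsJordanLoop.fill γ = discLeaf F ι K.y)
    (Q : D.PolyCycle hbi (discLeaf F ι x₀)) (hQ : ∀ i (q : F.Leaf (Q.sx i)), ι (Leaf.pt q) ∈ IsJordanLoop.fill γ)
    (hess : ¬ (Q.leafLoop hι hC₀).Homotopic (Path.refl _)) (i : Fin Q.m) (q : F.Leaf (Q.sx i)) :
    ι (Leaf.pt q) ∈ range γ := by
  exfalso
  haveI := Q.neZero
  -- the fill of the polygon lies in the disc
  have hrange : range (Q.loop hι hC₀) ⊆ IsJordanLoop.fill γ := by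
    intro z hz
    rcases Q.mem_range_loop_cases hι hC₀ hz with ⟨j, rfl⟩ | ⟨j, y, hy, rfl⟩
    · have hω : Q.vtx j ∈ omegaSet hbi ι (Q.sx j) := by rw [Q.omega j]; exact mem_singleton _
      exact hJ.isClosed_fill.closure_subset (closure_mono (by rintro _ ⟨w, hw, rfl⟩; exact hQ j (Leaf.mk w hw))
        (limitSets_subset_closure hι (Or.inl hω)))
    · exact hQ j (Leaf.mk y hy)
  have hQfill : Q.fill hι hC₀ ⊆ discLeaf F ι K.y := by
    rw [← hfill, PolyCycle.fill_eq]; exact hJ.fill_subset_fill_of_range_subset_fill hrange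
  let Q' : D.PolyPattern hbi hι x₀ hC₀ := ⟨Q, hess⟩
  have heq : Q.fill hι hC₀ = discLeaf F ι K.y := hpterm Q' hQfill
  -- then a puncture of the polygon is on the compact leaf
  have hv : Q.vtx 0 ∈ range (Q.loop hι hC₀) := Q.vtx_mem_range hι hC₀ 0
  have hfr : frontier (Q.fill hι hC₀) = ι '' F.leaf K.y := by rw [heq, frontier_discLeaf hbi hι K.compact]
  have hvfr : Q.vtx 0 ∈ frontier (Q.fill hι hC₀) := by
    rw [PolyCycle.fill_eq, (Q.isJordanLoop_loop hι hC₀).frontier_fill]; exact hv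
  rw [hfr] at hvfr
  obtain ⟨w, -, hw⟩ := hvfr
  exact Q.vtx_not_mem_range 0 ⟨w, hw⟩

include hbi hι in
omit [Nonempty X] [NormedSpace ℝ B] [LocallyConnectedSpace B] in
/-- **A compact leaf meets the vertical of a flow box at one height**: the trace of a compact leaf
near any point of the domain is the plaque, in the strong form. [folklore] -/
theorem trace_eq_plaque {γ : ℝ → ℂ} (hr : range γ = ι '' F.leaf K.y) (xk : X)
    (hk : ι xk ∈ range γ) {e : OpenPartialHomeomorph X (ℝ × ℝ)} (he : e ∈ F.atlas) (hxke : xk ∈ e.source) :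
    ∃ ε > 0, ∀ x', ι x' ∈ range γ → x' ∈ e.source →
      |(e x').1 - (e xk).1| < ε → |(e x').2 - (e xk).2| < ε → (e x').2 = (e xk).2 := by
  haveI : Nontrivial X := nontrivial_of_foliation F K.y
  refine ⟨1, one_pos, fun x' hx' hx'e _ _ ↦ ?_⟩
  rw [hr] at hk hx'
  obtain ⟨w, hw, hwe⟩ := hk
  have hxk : xk ∈ F.leaf K.y := hι.injective hwe ▸ hw
  obtain ⟨w', hw', hwe'⟩ := hx'
  have hx'K : x' ∈ F.leaf K.y := hι.injective hwe' ▸ hw'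
  -- the plaque of `x'` crosses the vertical of `xk`
  have h1 : e.symm ((e xk).1, (e x').2) ∈ F.leaf K.y :=
    F.plaque_subset_leaf_of_mem he hx'K (mem_plaque_self hx'e) (F.symm_mem_plaque he _ _)
  have h2 : e.symm ((e xk).1, (e xk).2) ∈ F.leaf K.y := by
    rw [show ((e xk).1, (e xk).2) = e xk from rfl, e.left_inv hxke]; exact hxk
  exact compactLeaf_vert_subsingleton hbi hι K.compact he h1 h2

include K hbi hι ho hC₀ hΩ hterm hpterm in
/-- **A terminal essential compact leaf yields a vanishing cycle.** [cite: CamachoLinsNeto1985, Ch. VII §2] -/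
theorem nonempty_vanishingCycle_of_terminal : Nonempty T.VanishingCycle := by
  have hιc := hι.continuous
  -- the zone of the compact leaf
  obtain ⟨γ, hJ, hr, -, hfill⟩ := exists_isJordanLoop_leaf hbi hι K.compact
  have hγC : IsJordanLoop.fill γ ⊆ discLeaf F ι x₀ := hfill ▸ K.sub
  have hsat : ∀ x', ι x' ∈ range γ → ∀ x'' ∈ F.leaf x', ι x'' ∈ range γ := by
    intro x' hx' x'' hx''
    rw [hr] at hx' ⊢
    obtain ⟨w, hw, hwe⟩ := hx'
    have : x' ∈ F.leaf K.y := hι.injective hwe ▸ hw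
    exact ⟨x'', by rw [← leaf_eq_of_mem this]; exact hx'', rfl⟩
  have hcpt := K.imageNull_of_compact_inside hbi hι hterm hr hfill
  have hpoly := K.mem_range_of_essential hbi hι hC₀ hpterm hJ hfill
  have hlocAll : ∀ xk, ι xk ∈ range γ → ∃ e ∈ F.atlas, xk ∈ e.source ∧ ∃ ε > 0, ∀ x', ι x' ∈ range γ → x' ∈ e.source →
      |(e x').1 - (e xk).1| < ε → |(e x').2 - (e xk).2| < ε → (e x').2 = (e xk).2 := fun xk hk ↦ by
    obtain ⟨e, he, hxe⟩ := F.exists_mem_source xk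
    exact ⟨e, he, hxe, K.trace_eq_plaque hbi hι hr xk hk he hxe⟩
  -- the leaf loop of `K` has essential image
  obtain ⟨β, hc, hp, hinj, hsurj⟩ := exists_leafLoop_of_isCompact (x := K.y) hbi K.compact
  have hess : ¬ ((F.leafLoop (loopPath β hc hp) (continuous_toLeafSpace_loopPath β hc hp)).map
      D.foliated.continuous_leafMap).Homotopic (Path.refl _) := fun h ↦
    K.ess ⟨K.y, β, hc, hp, F.mem_leaf_self _, hinj, hsurj, h⟩
  -- a flow box at the base point, and the inner side
  obtain ⟨e₀, he₀, hx₀⟩ := F.exists_mem_source (loopBase β)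
  have hbase : loopBase β ∈ F.leaf K.y := loopBase_mem_leaf β
  have hbk : ι (loopBase β) ∈ range γ := by rw [hr]; exact ⟨_, hbase, rfl⟩
  obtain ⟨ε₁, hε₁, hloc⟩ := K.trace_eq_plaque hbi hι hr (loopBase β) hbk he₀ hx₀
  obtain ⟨s, hs, ε, hε, hin, -⟩ := exists_oneSided' hJ hsat hbk he₀ ⟨ε₁, hε₁, hloc⟩ hι hx₀
  -- the inner leaves through the vertical near the base are compact and image-null
  set sg : ℝ → X := fun t ↦ vert β e₀ (baseLevel β e₀ + s * t) with hsg
  have hsg0 : sg 0 = loopBase β := by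
    simp only [hsg, mul_zero, add_zero]; exact vert_baseLevel hx₀
  have hsgc : ContinuousWithinAt sg (Ioo 0 ε) 0 :=
    ((continuous_vert he₀).comp (continuous_const.add (continuous_const.mul continuous_id))).continuousWithinAt
  have hsgA : ∀ a ∈ Ioo 0 ε, ι (sg a) ∈ IsJordanLoop.inside γ := by
    intro a ha
    have habs : |s * a| = a := by rcases hs with rfl | rfl <;> simp [abs_of_pos ha.1]
    refine hin _ _ (by show |baseCoord β e₀ - (e₀ (loopBase β)).1| < ε; rw [baseCoord, sub_self, abs_zero]; exact hε)
      (by show |baseLevel β e₀ + s * a - (e₀ (loopBase β)).2| < ε; rw [baseLevel, add_sub_cancel_left, habs]; exact ha.2)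
      (by show 0 < s * (baseLevel β e₀ + s * a - (e₀ (loopBase β)).2)
          rw [baseLevel, add_sub_cancel_left, ← mul_assoc, show s * s = 1 by rcases hs with rfl | rfl <;> norm_num, one_mul]
          exact ha.1)
  have hev := D.eventually_compact_imageNull hbi hι ho hC₀ hΩ hJ hγC hsat hcpt hpoly hlocAll hsgc (by rw [hsg0]; exact hbk) hsgA
  obtain ⟨δ₁, hδ₁, hδ⟩ : ∃ δ₁ > 0, ∀ a ∈ Ioo 0 ε, dist a 0 < δ₁ → IsCompact (F.leaf (sg a)) ∧ ImageNull D.foliated (sg a) := by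
    rw [eventually_nhdsWithin_iff, Metric.eventually_nhds_iff] at hev
    obtain ⟨δ₁, hδ₁, h⟩ := hev
    exact ⟨δ₁, hδ₁, fun a ha hd ↦ h hd ha⟩
  set δ := min δ₁ ε with hδdef
  have hband : ∀ t ∈ Ioo 0 δ, ImageNull D.foliated (vert β e₀ (baseLevel β e₀ + s * t)) := by
    intro t ht
    have hd : dist t 0 < δ₁ := by
      rw [dist_zero_right, Real.norm_eq_abs, abs_of_pos ht.1]; exact ht.2.trans_le (min_le_left _ _)
    exact (hδ t ⟨ht.1, ht.2.trans_le (min_le_right _ _)⟩ hd).2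
  obtain ⟨C, -⟩ := exists_vanishingCycle hbi hι ho D.foliated hc hp he₀ hx₀ hess hs (lt_min hδ₁ hε) hband
  exact ⟨C⟩

end CompactPattern

/-! ## A terminal polygon is a terminal zone -/

namespace PolyPattern

variable {D} (P : D.PolyPattern hbi hι x₀ hC₀)
  (hterm : ∀ Q : D.PolyPattern hbi hι x₀ hC₀, Q.Z.fill hι hC₀ ⊆ P.Z.fill hι hC₀ → Q.Z.fill hι hC₀ = P.Z.fill hι hC₀)
  (hcterm : ∀ Q : D.CompactPattern x₀, discLeaf F ι Q.y ⊆ P.Z.fill hι hC₀ → discLeaf F ι Q.y = P.Z.fill hι hC₀)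

include hK₀ hcterm in
omit [NormedSpace ℝ B] [LocallyConnectedSpace B] in
/-- **Inside a terminal polygon, compact leaves off the trace are image-null.** [folklore] -/
theorem imageNull_of_compact_inside (y' : X) (hK' : IsCompact (F.leaf y'))
    (hsub : ι '' F.leaf y' ⊆ IsJordanLoop.fill (P.Z.loop hι hC₀)) (hdis : Disjoint (ι '' F.leaf y') (range (P.Z.loop hι hC₀))) :
    ImageNull D.foliated y' := by
  by_contra hess
  haveI := P.Z.neZero
  have hJ := P.Z.isJordanLoop_loop hι hC₀
  have hdisc : discLeaf F ι y' ⊆ P.Z.fill hι hC₀ := discLeaf_subset_fill_of_image_subset_fill hbi hι hK' hJ hsub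
  let Q : D.CompactPattern x₀ := ⟨y', hK', hdisc.trans (P.fill_subset hK₀), hess⟩
  have heq : discLeaf F ι y' = P.Z.fill hι hC₀ := hcterm Q hdisc
  have hfr : ι '' F.leaf y' ⊆ range (P.Z.loop hι hC₀) := by
    rw [← frontier_discLeaf hbi hι hK', heq]; exact P.Z.frontier_fill_subset hι hC₀
  exact (disjoint_left.1 hdis ⟨y', F.mem_leaf_self y', rfl⟩) (hfr ⟨y', F.mem_leaf_self y', rfl⟩)

include hterm in
omit [NormedSpace ℝ B] [LocallyConnectedSpace B] in
/-- **Inside a terminal polygon, an essential polygon is on the trace.** [folklore] -/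
theorem mem_range_of_essential (Q : D.PolyCycle hbi (discLeaf F ι x₀))
    (hQ : ∀ i (q : F.Leaf (Q.sx i)), ι (Leaf.pt q) ∈ IsJordanLoop.fill (P.Z.loop hι hC₀))
    (hess : ¬ (Q.leafLoop hι hC₀).Homotopic (Path.refl _)) (i : Fin Q.m) (q : F.Leaf (Q.sx i)) :
    ι (Leaf.pt q) ∈ range (P.Z.loop hι hC₀) := by
  haveI := Q.neZero
  haveI := P.Z.neZero
  have hJ := P.Z.isJordanLoop_loop hι hC₀
  have hJQ := Q.isJordanLoop_loop hι hC₀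
  have hrange : range (Q.loop hι hC₀) ⊆ IsJordanLoop.fill (P.Z.loop hι hC₀) := by
    intro z hz
    rcases Q.mem_range_loop_cases hι hC₀ hz with ⟨j, rfl⟩ | ⟨j, y, hy, rfl⟩
    · have hω : Q.vtx j ∈ omegaSet hbi ι (Q.sx j) := by rw [Q.omega j]; exact mem_singleton _
      exact hJ.isClosed_fill.closure_subset (closure_mono (by rintro _ ⟨w, hw, rfl⟩; exact hQ j (Leaf.mk w hw))
        (limitSets_subset_closure hι (Or.inl hω)))
    · exact hQ j (Leaf.mk y hy)
  have hQfill : Q.fill hι hC₀ ⊆ P.Z.fill hι hC₀ := by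
    rw [PolyCycle.fill_eq]; exact hJ.fill_subset_fill_of_range_subset_fill hrange
  let Q' : D.PolyPattern hbi hι x₀ hC₀ := ⟨Q, hess⟩
  have heq : Q.fill hι hC₀ = P.Z.fill hι hC₀ := hterm Q' hQfill
  have hr : range (Q.loop hι hC₀) = range (P.Z.loop hι hC₀) := by
    rw [← hJQ.frontier_fill, ← hJ.frontier_fill]
    exact congrArg frontier heq
  rw [← hr]
  exact Q.image_leaf_subset_range hι hC₀ i ⟨Leaf.pt q, q.2, rfl⟩

end PolyPattern

end StarData

end Literature.Topology.PlanarFoliations
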